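import Summits.QuantumFields.YangMills.Theorems.BalabanLadderIRTwistedSlabExponent
import Literature.Analysis.Matrix.DetExp
import HarnessLib

/-!
# The exponential line `t ↦ e^{t a} · U` INSIDE `SU(N)^E` (Liouville: `det e^X = e^{tr X}`), and the family-free form of K3: the second
# variation of `twistedExponent` along it has the Coulomb-gauge gap `4 sin²(π/(Nℓ₀))` at every classical vacuum, uniformly in `L, T`

HELPER toward stub **T1** `TwistedSlabAnchor` (LINE `twisted-slab-continuity`, crux `IRcof` stmt-QuantumFields-26930, census row 43;
LEAD prover ym-ir-line-tsc-p1 g3; `--supports` the crux, `--as helper`).  K3e∕K3f∕K9 quantified over `SU(N)`-valued families `V t` with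
`↑(V t e) = e^{t a_e}·↑(U e)` because «`det (exp X) = exp (tr X)` is a Mathlib TODO»; the TREE has it (`Literature.Analysis.Matrix.det_exp_eq_exp_trace`,
Liouville), so the canonical family exists and the hypothesis is discharged here.
* §1 `exp_smul_mem_specialUnitaryGroup` (skew-Hermitian traceless `a`, real `t` ⇒ `e^{t a} ∈ SU(N)`; Mathlib's `NormedSpace.exp_mem_unitary_of_mem_skewAdjoint`
  + the tree's Liouville formula), ★ `expLine U a hskew htr t` — the `SU(N)`-valued configuration `e ↦ e^{t a_e} · U e`; `coe_expLine` (`rfl`-shape),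
  `expLine_zero` (`= U`).
* §2 ★ `twistedExponent_expLine_eq_lineAction`; `twistedExponent_expLine_zero`, `deriv_twistedExponent_expLine_zero` (value `0` and criticality at a vacuum);
  ★★★ `twistedExponent_hessian_gap_expLine`: `SU(N)`, `k` a unit, ANY box `(m+1)² × (m₂+1) × (m₃+1)`, ANY `U` with `twistedExponent k U = 0`, any traceless
  skew-Hermitian `a` with `div_U a = 0`:  `4 sin²(π/(N(m+1))) · Σ_x Σ_μ S(a_μ x) ≤ d²/dt²|₀ twistedExponent k (e^{t a} · U)` — no auxiliary family, no ladder,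
  constants uniform in the long extents.  With K9's `rfl` link this is a statement about the integrand of `wilsonFinTorusTensorTwistedPartition` itself.
NOT here: M1b (slice chart ∕ Haar density ∕ Jacobian), anything uniform in `β` (M3), the cluster expansion (M4); T1-box 0∕1, T1 proper 0∕1.

HONEST FRAMING: tree-level calculus on one box; nothing here bears on `IRcof`, `IR`, or the Yang–Mills mass gap (Clay: NOT proved); R4 = `BalabanLadder.UV`
only.  References: B. C. Hall, *Lie Groups, Lie Algebras, and Representations* (2015) Thm 2.12 (Liouville's formula); M. García Pérez, A. González-Arroyo,
M. Okawa, JHEP 10 (2017) 150 §2.3 (`U_μ = e^{−igA_μ}Γ_μ`).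
-/

set_option autoImplicit false

noncomputable section

open scoped Matrix Matrix.Norms.Frobenius
open Finset NormedSpace
open Literature.MathematicalPhysics.QuantumFieldTheory Literature.MathematicalPhysics.QuantumLattice
open Literature.MathematicalPhysics.QuantumLattice.WilsonSecondVariation

namespace Summit.QuantumFields.YangMills.Cruxes.IRcof.TwistedSlab

variable {N : ℕ} {n₀ n₁ n₂ n₃ : ℕ}

/-! ## §1 The exponential line inside `SU(N)^E` -/

section ExpLine

/-- `e^{X} ∈ SU(N)` for skew-Hermitian traceless `X`: unitary by Mathlib's `exp_mem_unitary_of_mem_skewAdjoint`, determinant one by the tree's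
Liouville formula `det e^X = e^{tr X}` (public under another hypothesis shape in B89's `T4AdjointCovarianceUnitary`). [folklore] -/
theorem exp_mem_specialUnitaryGroup_of_conjTranspose {X : Matrix (Fin N) (Fin N) ℂ} (hX : Xᴴ = -X) (htr : X.trace = 0) :
    exp X ∈ Matrix.specialUnitaryGroup (Fin N) ℂ := by
  letI : NormedAlgebra ℚ (Matrix (Fin N) (Fin N) ℂ) := NormedAlgebra.restrictScalars ℚ ℂ (Matrix (Fin N) (Fin N) ℂ)
  rw [Matrix.mem_specialUnitaryGroup_iff]
  refine ⟨?_, ?_⟩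
  · exact exp_mem_unitary_of_mem_skewAdjoint (by rw [skewAdjoint.mem_iff, Matrix.star_eq_conjTranspose, hX])
  · rw [Literature.Analysis.Matrix.det_exp_eq_exp_trace, htr, exp_zero]

/-- `e^{t a} ∈ SU(N)` for skew-Hermitian traceless `a` and real `t`. [folklore] -/
theorem exp_smul_mem_specialUnitaryGroup {X : Matrix (Fin N) (Fin N) ℂ} (hX : Xᴴ = -X) (htr : X.trace = 0) (t : ℝ) :
    exp (t • X) ∈ Matrix.specialUnitaryGroup (Fin N) ℂ :=
  exp_mem_specialUnitaryGroup_of_conjTranspose (by rw [Matrix.conjTranspose_smul, star_trivial, hX, smul_neg])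
    (by rw [Matrix.trace_smul, htr, smul_zero])

variable (U : FinTorusSite n₀ n₁ n₂ n₃ × Fin 4 → Matrix.specialUnitaryGroup (Fin N) ℂ)
  {a : Fin 4 → FinTorusSite n₀ n₁ n₂ n₃ → Matrix (Fin N) (Fin N) ℂ}
  (hskew : ∀ μ x, (a μ x)ᴴ = -a μ x) (htr : ∀ μ x, (a μ x).trace = 0)

/-- ★ **The exponential line through `U` in the direction `a`**, as an `SU(N)`-valued configuration: `(x, μ) ↦ e^{t a_μ(x)} · U(x, μ)`
(GPGAO's `U_μ(n) = e^{−igA_μ(n)} Γ_μ(n)`). [cite: GarciaperezGonzalezarroyoOkawa2017, §2.3] -/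
def expLine (t : ℝ) : FinTorusSite n₀ n₁ n₂ n₃ × Fin 4 → Matrix.specialUnitaryGroup (Fin N) ℂ :=
  fun e => ⟨exp (t • a e.2 e.1), exp_smul_mem_specialUnitaryGroup (hskew e.2 e.1) (htr e.2 e.1) t⟩ * U e

/-- The matrix of the exponential line: `↑(expLine U a t (x,μ)) = e^{t a_μ(x)} · ↑(U (x,μ))`. [folklore] -/
theorem coe_expLine (t : ℝ) (x : FinTorusSite n₀ n₁ n₂ n₃) (μ : Fin 4) :
    ((expLine U hskew htr t (x, μ) : Matrix.specialUnitaryGroup (Fin N) ℂ) : Matrix (Fin N) (Fin N) ℂ) =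
      exp (t • a μ x) * (U (x, μ) : Matrix (Fin N) (Fin N) ℂ) := rfl

/-- At `t = 0` the line passes through `U`. [folklore] -/
theorem expLine_zero : expLine U hskew htr 0 = U := by
  funext e
  apply Subtype.ext
  show exp ((0 : ℝ) • a e.2 e.1) * (U e : Matrix (Fin N) (Fin N) ℂ) = (U e : Matrix (Fin N) (Fin N) ℂ)
  rw [zero_smul, exp_zero, Matrix.one_mul]

end ExpLine

/-! ## §2 The family-free form of K3 ∕ K9 -/

section Gap

variable {m m₂ m₃ : ℕ}

/-- ★ **Along the exponential line the exponent is `lineAction`** (K3e with the canonical family). [cite: GarciaperezGonzalezarroyoOkawa2017, §2.3 (2.3)] -/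
theorem twistedExponent_expLine_eq_lineAction (k : ZMod N) (U : FinTorusSite n₀ n₁ n₂ n₃ × Fin 4 → Matrix.specialUnitaryGroup (Fin N) ℂ)
    {a : Fin 4 → FinTorusSite n₀ n₁ n₂ n₃ → Matrix (Fin N) (Fin N) ℂ} (hskew : ∀ μ x, (a μ x)ᴴ = -a μ x) (htr : ∀ μ x, (a μ x).trace = 0) :
    (fun t => twistedExponent k (expLine U hskew htr t)) = lineAction (fun e => (U e : Matrix (Fin N) (Fin N) ℂ)) a (slabTwistPhase k) :=
  twistedExponent_along_eq_lineAction k U a (expLine U hskew htr) (fun t x μ => coe_expLine U hskew htr t x μ)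

/-- **At a vacuum the exponent vanishes along the line at `t = 0`.** [cite: Gonzalezarroyo1998, §4.2] -/
theorem twistedExponent_expLine_zero (k : ZMod N) (U : FinTorusSite n₀ n₁ n₂ n₃ × Fin 4 → Matrix.specialUnitaryGroup (Fin N) ℂ)
    {a : Fin 4 → FinTorusSite n₀ n₁ n₂ n₃ → Matrix (Fin N) (Fin N) ℂ} (hskew : ∀ μ x, (a μ x)ᴴ = -a μ x) (htr : ∀ μ x, (a μ x).trace = 0)
    (hU : twistedExponent k U = 0) : twistedExponent k (expLine U hskew htr 0) = 0 := by
  rw [expLine_zero]; exact hU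

/-- ★ **Criticality**: at a zero of the exponent the first variation along every exponential line (skew-Hermitian traceless direction) vanishes —
the classical vacua are critical points of the T1 integrand's exponent ON `SU(N)^E`. [cite: GarciaperezGonzalezarroyoOkawa2017, §2.2–2.3] -/
theorem deriv_twistedExponent_expLine_zero [NeZero N] {k : ZMod N} (hk : IsUnit k)
    (U : FinTorusSite (m + 1) (m + 1) (m₂ + 1) (m₃ + 1) × Fin 4 → Matrix.specialUnitaryGroup (Fin N) ℂ) (hU : twistedExponent k U = 0)
    {a : Fin 4 → FinTorusSite (m + 1) (m + 1) (m₂ + 1) (m₃ + 1) → Matrix (Fin N) (Fin N) ℂ}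
    (hskew : ∀ μ x, (a μ x)ᴴ = -a μ x) (htr : ∀ μ x, (a μ x).trace = 0) :
    deriv (fun t => twistedExponent k (expLine U hskew htr t)) 0 = 0 := by
  -- K2: `U = g • ladder`; the line action at `g • L` is the line action at `L` in the conjugated direction (K5 `lineAction_gaugeAct`)
  obtain ⟨B, A, hBA⟩ := exists_pair_commutator_eq_suCenter (N := N) k
  obtain ⟨g, i, j, rfl⟩ := (twistedExponent_eq_zero_iff hk hBA U).1 hU
  have hg : ∀ y, ((g y : Matrix.specialUnitaryGroup (Fin N) ℂ) : Matrix (Fin N) (Fin N) ℂ) ∈ Matrix.unitaryGroup (Fin N) ℂ := fun y => (g y).2.1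
  rw [twistedExponent_expLine_eq_lineAction, lineAction_gaugeAct, coe_ladderConfig_pair]
  exact deriv_twistedAction_along_zero hBA i j (conjFluct_skew hskew)

/-- ★★★ **K3, FAMILY-FREE AND LADDER-FREE.**  `SU(N)`, `k` a unit, ANY box `(m+1) × (m+1) × (m₂+1) × (m₃+1)`, ANY configuration `U` with
`twistedExponent k U = 0` (a classical vacuum of the e₂-projected slab weight's magnetic summands), any traceless skew-Hermitian lattice 1-form `a` on
the Coulomb slice of `U`:
`4 sin²(π/(N(m+1))) · Σ_x Σ_μ S(a_μ x) ≤ d²/dt²|₀ twistedExponent k (e^{t a} · U)`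
— the second variation of the integrand exponent of `wilsonFinTorusTensorTwistedPartition (fundamentalRep (Fin N)) β (slabTwist (ω^k·1) 1)` (K9's `rfl` link)
along the exponential line INSIDE `SU(N)^E`; the constant does not depend on the long extents `m₂ + 1 = L`, `m₃ + 1 = T`.
[cite: GarciaperezGonzalezarroyoOkawa2017, §2.2, §2.3, §2.5] [cite: GarciaperezGonzalezarroyoOkawa2014, §3] -/
theorem twistedExponent_hessian_gap_expLine [NeZero N] {k : ZMod N} (hk : IsUnit k)
    (U : FinTorusSite (m + 1) (m + 1) (m₂ + 1) (m₃ + 1) × Fin 4 → Matrix.specialUnitaryGroup (Fin N) ℂ) (hU : twistedExponent k U = 0)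
    {a : Fin 4 → FinTorusSite (m + 1) (m + 1) (m₂ + 1) (m₃ + 1) → Matrix (Fin N) (Fin N) ℂ}
    (hskew : ∀ μ x, (a μ x)ᴴ = -a μ x) (htr : ∀ μ x, (a μ x).trace = 0)
    (hdiv : ∀ x, covDiv (fun e => ((U e : Matrix.specialUnitaryGroup (Fin N) ℂ) : Matrix (Fin N) (Fin N) ℂ)) a x = 0) :
    4 * Real.sin (Real.pi / ((N : ℝ) * (m + 1 : ℕ))) ^ 2 * ∑ x, ∑ μ, (((a μ x)ᴴ * a μ x).trace).re ≤
      iteratedDeriv 2 (fun t => twistedExponent k (expLine U hskew htr t)) 0 :=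
  twistedExponent_hessian_gap_of_vacuum hk U hU hskew htr hdiv (expLine U hskew htr) (fun t x μ => coe_expLine U hskew htr t x μ)

/-- ★★ The same, read through the exponential chart: `d²/dt²|₀ twistedExponent k (e^{t a}·U) = D²chartAction_{↑U}(0)(a, a)` — the line Hessian of the
exponent INSIDE `SU(N)^E` is the Hessian bilinear form of the `C^∞` chart action (K4∕K5). [cite: Breitung1994, Thm 41 proof (5.34)] -/
theorem iteratedDeriv_two_twistedExponent_expLine_eq_hessian (k : ZMod N)
    (U : FinTorusSite n₀ n₁ n₂ n₃ × Fin 4 → Matrix.specialUnitaryGroup (Fin N) ℂ)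
    {a : Fin 4 → FinTorusSite n₀ n₁ n₂ n₃ → Matrix (Fin N) (Fin N) ℂ} (hskew : ∀ μ x, (a μ x)ᴴ = -a μ x) (htr : ∀ μ x, (a μ x).trace = 0) :
    iteratedDeriv 2 (fun t => twistedExponent k (expLine U hskew htr t)) 0 =
      fderiv ℝ (fderiv ℝ (chartAction (fun e => (U e : Matrix (Fin N) (Fin N) ℂ)) (slabTwistPhase k))) 0 a a := by
  rw [twistedExponent_expLine_eq_lineAction, fderiv_fderiv_chartAction_apply_self]

end Gap

end Summit.QuantumFields.YangMills.Cruxes.IRcof.TwistedSlab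

end
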